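import Literature.MathematicalPhysics.QuantumFieldTheory.Balaban1983to89.B6Cor28TwoScaleV1
import Literature.MathematicalPhysics.QuantumFieldTheory.Balaban1983to89.B6TwoScaleGeometryV1

/-!
# `Balaban1983to89.B6Cor28PrintedTwoScaleV1` — T. Bałaban, *Propagators and renormalization transformations for lattice gauge theories. II*,
# Commun. Math. Phys. **96** (1984) 223–250 [Balaban1984PropagatorsII], p. 249 **COROLLARY 2.8 — THE VERBATIM CENSUS TYPING `…B6.Cor28Printed`
# INHABITED ON THE GENUINE TWO-SCALE FAMILY** (two adjacent levels `Λ^c ⊔ Λ′`, `Λ′ ⊂ T^{(j+1)}` ARBITRARY, every volume, every `j`, all weights of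
# [4]'s window) **BY THE GENUINE `H = GQ*(QGQ*)⁻¹` OF `tsV1`** — all three entries `|H(b,c)|`, `|(∇H)(b,c)|`, `‖(ζ∇H)(·,c)‖_α`, ONE `δ₅(d, L, a₀, a₁)`

statement-level skeleton of published theorems with citation tags; proofs where landed; nothing here is a claim about the Yang–Mills mass gap

PRINT (verbatim, p. 249 [PDF 27], = the docstring of `…B6.Cor28Printed`): *"Corollary 2.8. A kernel of the operator H, (HB)(b) = Σ_{c∈𝔅}(L^{j(c)}η)^d
H(b, c)B(c), (2.150) satisfies the inequality |H(b, c)|, |(∇H)(b, c)|, ‖(ζ∇H)(·, c)‖_α ≦ O(1)[1, (L^jη)^{−1}, (L^jη)^{−1−α}(‖ζ‖^ξ_α + |ζ|)](L^{j′}η)^{−d}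
e^{−δ₅d(y,c₋)}, (1.151)[sic] b ∈ Δ(y) or supp ζ ⊂ Δ(y), y ∈ Λ_j, c₋ ∈ Λ_{j′}. This Corollary and Proposition 2.6 are our main technical results."*

CITATION HEADER (lean-in-tree rule) — WHAT IS REPRODUCED.  Phase-2 file of the `lit-balaban` typed skeleton (HOME `run/shared/lean/pub/lit-balaban/`),
seat **p22 gen 17** (B6 fold owner r03, referee ref-4).  SKELETON row **B6.Cor2.8** (head `proved p254241`: p01's `…B6Cor28OneScaleTorus.cor28Printed_oneScaleTorus`,
ONE scale; r03's `…B6MainResultsOneLevel.cor28Printed_block`, the cube geometry of Prop. 2.6).  THIS FILE = the TWO-SCALE member instance: the verbatim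
`B6.Cor28Printed (d + 1)` INHABITED, hypothesis-free, on the family of all genuine two-scale data `tsV1` (index: volume `(m, K)`, level `j + 1 ≤ m + K`,
`Λ′ ⊂ T^{(j+1)}`, weights `a₀n^{d+1} ≤ w ≤ a₁n^{d+1}`), by gen 17's `…B6Eq235TwoScaleV1.Hts = G·Q*·(QGQ*)⁻¹` read through honest `B6.Geometry`/`B6.HFamily`
readings (§1–§2), the three members being gen 17's `…B6Cor28TwoScaleV1.blockBound_Hts_scaling` / `blockBound_DHts_scaling` / `cor28_ineq2151_holder`
(α-FREE rate, through r03's `…B6Prop25HolderRateFreeV1`).  IMPORTS BY NAME, nothing restated: `…B6` (`Geometry`, `HFamily`, `Cor28Printed`),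
`…B6Cor28TwoScaleV1`, `…B6Eq235TwoScaleV1.Hts`, `…B6TwoScaleGeometryV1` (`Frame`, `twoScaleGeo`, `len_rpow_neg_ge`, `one_le_rpow_mul_len`, `supF`/`holderF` lemmas).

THE TWO-SCALE FAMILY.  The weight-free frame `(m, K, j, Λ′)` and its `B6.Geometry` `twoScaleGeo` (index set `𝔅 = Λ^c ⊔ Λ′` as `Site`, scales `j`/`j+1`,
`η = L^{−j}`, `dist` = the sup-distance of `T^{(j)}` between index sites — dominating (2.46) —, `M = 1`, the cut-off vocabulary `cutIn`/`cutH`/`supF`/`holderF`)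
are gen 17's `…B6TwoScaleGeometryV1` (every reading stated there, once); here the index adds the weights `a₀n^{d+1} ≤ w ≤ a₁n^{d+1}` of [4]'s window at the
paper's scaling `c = L^j`, and the `HFamily` readings are: `e 0 y c = max_{b : |y(b₋) − site(y)|_T ≤ L}|H(e_c)(b)|`, `e 1 y c = max_{b, λ}|n((He_c)(b + e_λ) −
(He_c)(b))|` (same `b`), `h α ζ c` = the (1.109) quotient of `ζ·∇_λ(He_c)_ν` over pairs of fine sites at sup-distance `≤ n` (`0` beyond).

THIS FILE: §1 the index `Index` (a `Frame` + weights; `Index.H` = gen 17's `Hts` at `c = L^j`); §2 the readings `twoScaleH` and two facts on basis vectors;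
§3 **`cor28Printed_twoScale : B6.Cor28Printed (d + 1) (fun i => twoScaleGeo i.toFrame) (fun i => twoScaleH i)`** (the three entries proved inline from the
three theorems of `…B6Cor28TwoScaleV1`)
(witnesses `M₁ = 1`, `δ₅ = min` of the three rates of `…B6Cor28TwoScaleV1`, `O(1) = (C_He^{δ_HL} + C_{∇H}e^{δ_{∇H}L})·L·L^{d+1} + 1`,
`C(α) = C_α·e^{(1+2δ_α)(L+1)}·L²·L^{d+1}`) and the non-vacuity `twoScale_meets_hypotheses`.  DEFINITIONS (data: the geometry, the readings, the index) + THEOREMS; no `def … : Prop` fact; standard axioms.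
HONEST SCOPE / DIVERGENCES: two adjacent levels only (print: `k + 1` levels); the distance, cube and length readings of `…B6TwoScaleGeometryV1` (constants
depending on `d, L` absorbed in `O(1)`); `δ₅, O(1)` depend on `d, L` AND the weight ratios `a₀, a₁`; our entries are the unweighted `ℓ²(𝔅)` ones (= print's
`(L^{j(c)}η)^dH(b,c)`, the normalisation (2.150)); `∇` = the `ξ = L^{−j}`-lattice difference quotient.  NOT summit progress.
Unit `lit-balaban-p22` (gen 17), 2026-08-22.
-/

noncomputable section

open scoped InnerProductSpace
open Finset

namespace Literature.MathematicalPhysics.QuantumFieldTheory.Balaban1983to89.B6Cor28PrintedTwoScaleV1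

open LatticeFieldCalculus B6SectAOperatorsV1 B6SectCTwoScaleV1 B6SectCTwoScaleV1Lattice B5Eq118OneStroke
open B4Sect5Torus (IsPseudoDist)
open B4TorusKernel.MultiPeriod (torusSupNorm)
open B5Eq117TorusCarriers (Mk)
open B6LowerBound2153Torus (rep)
open BalabanImbrieJaffe1984to88.BIJ85AxialPropagator411 (BondSpace)
open B6BlockDecayCalculus (torusDist_isPseudoDist)
open B6BlockDecayGradFactorsV1 (Dop_comp_apply)
open B6Eq235TwoScaleV1 (Hts)
open B6Cor28TwoScaleV1 (blockBound_Hts_scaling blockBound_DHts_scaling cor28_ineq2151_holder)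
open B3TorusRadialSums (supDist_eq_zero_iff)
open B6TwoScaleGeometryV1 (Frame twoScaleGeo len_eq len_rpow_neg_ge one_le_rpow_mul_len)

variable (d L : ℕ) (hd : 1 ≤ d + 1) (hL : Odd L ∧ 1 < L) (a₀ a₁ : ℝ)

/-! ## §1  The index of the family: a frame (volume, level, region) and weights of the window -/

/-- the index of the genuine two-scale family at the paper's scaling `c = L^j`: a frame `(m, K, j, Λ′)` of `…B6TwoScaleGeometryV1` and weights
`a₀n^{d+1} ≤ w ≤ a₁n^{d+1}` on `𝔅 = Λ^c ⊔ Λ′` ([4]'s window `a₀ ≤ a ≤ a₁` in the V1 normalisation). [cite: Balaban1984PropagatorsII, (2.97) p.240, (2.143) p.248] -/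
structure Index extends Frame d L hd hL where
  /-- the weights on `𝔅 = Λ^c ⊔ Λ′` -/
  w : CIdx j Λ' → ℝ
  hw0 : ∀ i, a₀ * ((L : ℝ) ^ j) ^ (d + 1) ≤ w i
  hw1 : ∀ i, w i ≤ a₁ * ((L : ℝ) ^ j) ^ (d + 1)

variable {d L hd hL a₀ a₁}

namespace Index

variable (i : Index d L hd hL a₀ a₁)

/-- **the `H = GQ*(QGQ*)⁻¹` of the member** (gen 17's `…B6Eq235TwoScaleV1.Hts` at `c = L^j`). [cite: Balaban1984PropagatorsII, (2.35) p.228, (2.150) p.249] -/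
abbrev H : CSpace i.j i.Λ' →ₗ[ℝ] BondSpace i.P := Hts i.pow_ne_zero' i.Λ' (w := i.w)

end Index

/-! ## §2  The readings of `H = GQ*(QGQ*)⁻¹` and the elementary inequalities of the cut-off norms -/

open Classical in
/-- **the family `H = GQ*(QGQ*)⁻¹` of Corollary 2.8 on the two-scale data**, read through its three quantities (module docstring).
[cite: Balaban1984PropagatorsII, Cor. 2.8 (2.150)–(2.151) p.249; (2.35) p.228] -/
def twoScaleH (i : Index d L hd hL a₀ a₁) : B6.HFamily (twoScaleGeo i.toFrame) where
  e := fun n y c =>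
    if n = 0 then
      ⨆ b₀ : PBond i.P 0, if i.ρ (iterBlockOf i.j b₀.src) (i.site y) ≤ L then
        |i.H (EuclideanSpace.single c (1 : ℝ)) b₀| else 0
    else
      ⨆ q : PBond i.P 0 × Fin (d + 1), if i.ρ (iterBlockOf i.j q.1.src) (i.site y) ≤ L then
        |((L : ℝ) ^ i.j) * (i.H (EuclideanSpace.single c (1 : ℝ)) ⟨q.1.src.shift q.2, q.1.dir⟩ - i.H (EuclideanSpace.single c (1 : ℝ)) q.1)| else 0
  h := fun α ζ c =>
    ⨆ q : (Site i.P 0 × Site i.P 0) × Fin (d + 1) × Fin (d + 1),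
      if supDist q.1.1 q.1.2 ≤ L ^ i.j then
        |ζ q.1.1 * (((L : ℝ) ^ i.j) * (i.H (EuclideanSpace.single c (1 : ℝ)) ⟨q.1.1.shift q.2.2, q.2.1⟩ - i.H (EuclideanSpace.single c (1 : ℝ)) ⟨q.1.1, q.2.1⟩)) -
          ζ q.1.2 * (((L : ℝ) ^ i.j) * (i.H (EuclideanSpace.single c (1 : ℝ)) ⟨q.1.2.shift q.2.2, q.2.1⟩ - i.H (EuclideanSpace.single c (1 : ℝ)) ⟨q.1.2, q.2.1⟩))| /
          (((supDist q.1.1 q.1.2 : ℕ) : ℝ) / (L : ℝ) ^ i.j) ^ α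
      else 0

/-! ### elementary facts on the basis vectors -/

section Basis

variable {ι : Type} [DecidableEq ι]

/-- `e_c(k) ≠ 0 ⇒ k = c`. [folklore] -/
private theorem eq_of_single_ne_zero {c k : ι} (h : EuclideanSpace.single c (1 : ℝ) k ≠ 0) : k = c := by
  by_contra hk
  exact h (by rw [PiLp.single_apply, if_neg hk])

/-- `|e_c(k)| ≤ 1`. [folklore] -/
private theorem abs_single_le_one (c k : ι) : |EuclideanSpace.single c (1 : ℝ) k| ≤ 1 := by
  rw [PiLp.single_apply]
  split_ifs <;> simp

end Basis

/-! ## §3  Corollary 2.8 verbatim on the two-scale family -/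

open Classical in
/-- **COROLLARY 2.8, VERBATIM (`B6.Cor28Printed`), ON THE GENUINE TWO-SCALE FAMILY WITH NO HYPOTHESIS**: for every dimension `d + 1`, odd `L > 1`
and weight window `0 < a₀ ≤ a₁` the census Prop holds for the family of all two-scale data `tsV1` (all volumes, all levels `j + 1 ≤ m + K`, all
`Λ′ ⊂ T^{(j+1)}`, all weights of the window) with `H = GQ*(QGQ*)⁻¹` (`…B6Eq235TwoScaleV1.Hts`) — witnesses `M₁ = 1`, ONE `δ₅ > 0` (the least of the
three rates of `…B6Cor28TwoScaleV1`), `O(1)`, `C(α)` depending on `d, L, a₀, a₁` (and `α`).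
[cite: Balaban1984PropagatorsII, Cor. 2.8 (2.150)–(2.151) p.249] -/
theorem cor28Printed_twoScale (ha₀ : 0 < a₀) (ha₁ : a₀ ≤ a₁) :
    B6.Cor28Printed (d + 1) (fun i : Index d L hd hL a₀ a₁ => twoScaleGeo i.toFrame) (fun i => twoScaleH i) := by
  obtain ⟨δA, hδA, CA, hCA, hA⟩ := blockBound_Hts_scaling d L hd hL ha₀ ha₁
  obtain ⟨δB, hδB, CB, hCB, hB⟩ := blockBound_DHts_scaling d L hd hL ha₀ ha₁
  obtain ⟨δC, hδC, HC⟩ := cor28_ineq2151_holder d L hd hL ha₀ ha₁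
  have hL1 : (1 : ℝ) ≤ L := by exact_mod_cast hL.2.le
  have hL0 : (0 : ℝ) < L := by linarith
  -- the common rate and the constants
  set δ₅ : ℝ := min (min δA δB) δC with hδ₅
  have hδ₅0 : 0 < δ₅ := lt_min (lt_min hδA hδB) hδC
  have h5A : δ₅ ≤ δA := (min_le_left _ _).trans (min_le_left _ _)
  have h5B : δ₅ ≤ δB := (min_le_left _ _).trans (min_le_right _ _)
  have h5C : δ₅ ≤ δC := min_le_right _ _
  set C₀ : ℝ := ((CA * Real.exp (δA * L) + CB * Real.exp (δB * L)) * ((L : ℝ) ^ (1 : ℝ) * (L : ℝ) ^ (((d + 1 : ℕ) : ℝ))) + 1) with hC₀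
  have hC₀1 : 1 ≤ C₀ := by
    have : 0 ≤ (CA * Real.exp (δA * L) + CB * Real.exp (δB * L)) * ((L : ℝ) ^ (1 : ℝ) * (L : ℝ) ^ (((d + 1 : ℕ) : ℝ))) := by positivity
    linarith
  refine ⟨1, δ₅, C₀, fun α => if h : 0 ≤ α ∧ α < 1 then
      (Classical.choose (HC α h.1 h.2)) * Real.exp ((1 + 2 * δC) * ((L : ℝ) + 1)) * ((L : ℝ) ^ (2 : ℝ) * (L : ℝ) ^ (((d + 1 : ℕ) : ℝ))) else 0,
    one_pos, hδ₅0, lt_of_lt_of_le one_pos hC₀1, fun i _ _ => ⟨?_, ?_⟩⟩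
  · ------------------------------------------------------------------ the two entries `e 0`, `e 1`
    intro n y c
    have hρ := torusDist_isPseudoDist i.M
    haveI : Nonempty (PBond i.P 0) := ⟨⟨fun _ => 0, ⟨0, hd⟩⟩⟩
    -- the exponential factors: `e^{−δ_X ρ(blk b₀, site c)} ≤ e^{δ_X}·e^{−δ₅ dist(y,c)}` when `ρ(blk b₀, site y) ≤ 1`
    have hexp : ∀ {δX : ℝ}, δ₅ ≤ δX → ∀ b₀ : PBond i.P 0, i.ρ (iterBlockOf i.j b₀.src) (i.site y) ≤ L →
        Real.exp (-(δX * i.ρ (iterBlockOf i.j b₀.src) (i.site c))) ≤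
          Real.exp (δX * L) * Real.exp (-(δ₅ * (twoScaleGeo i.toFrame).dist y c)) := fun {δX} h5X b₀ hb => by
      have hδX : 0 ≤ δX := hδ₅0.le.trans h5X
      have htri : i.ρ (i.site y) (i.site c) ≤ L + i.ρ (iterBlockOf i.j b₀.src) (i.site c) := by
        have h1 := hρ.triangle (i.site y) (iterBlockOf i.j b₀.src) (i.site c)
        have h2 := hρ.symm (i.site y) (iterBlockOf i.j b₀.src)
        simp only [Frame.ρ] at h1 h2 hb ⊢
        linarith
      have hdist0 : 0 ≤ i.ρ (i.site y) (i.site c) := hρ.nonneg _ _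
      rw [← Real.exp_add]
      refine Real.exp_le_exp.2 ?_
      show -(δX * i.ρ (iterBlockOf i.j b₀.src) (i.site c)) ≤ δX * L + -(δ₅ * i.ρ (i.site y) (i.site c))
      have h1 := mul_le_mul_of_nonneg_left htri hδX
      have h2 := mul_le_mul_of_nonneg_right h5X hdist0
      nlinarith
    -- the value bound: `e n y c ≤ (C_A e^{δ_A} + C_B e^{δ_B})·e^{−δ₅ dist}`
    have key : (twoScaleH i).e n y c ≤ (CA * Real.exp (δA * L) + CB * Real.exp (δB * L)) * Real.exp (-(δ₅ * (twoScaleGeo i.toFrame).dist y c)) := by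
      have hApos : 0 ≤ CA * Real.exp (δA * L) * Real.exp (-(δ₅ * (twoScaleGeo i.toFrame).dist y c)) := by positivity
      have hBpos : 0 ≤ CB * Real.exp (δB * L) * Real.exp (-(δ₅ * (twoScaleGeo i.toFrame).dist y c)) := by positivity
      show (if n = 0 then (⨆ b₀ : PBond i.P 0, _) else (⨆ q : PBond i.P 0 × Fin (d + 1), _)) ≤ _
      split_ifs with hn
      · refine (ciSup_le fun b₀ => ?_).trans (show CA * Real.exp (δA * L) * Real.exp (-(δ₅ * (twoScaleGeo i.toFrame).dist y c)) ≤ _ by nlinarith)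
        split_ifs with hb
        · have h1 : |i.H (EuclideanSpace.single c (1 : ℝ)) b₀| ≤
              ∑ k ∈ univ.filter (fun k : CIdx i.j i.Λ' => i.site k = i.site c), |i.H (EuclideanSpace.single k (1 : ℝ)) b₀| :=
            Finset.single_le_sum (f := fun k : CIdx i.j i.Λ' => |i.H (EuclideanSpace.single k (1 : ℝ)) b₀|) (fun _ _ => abs_nonneg _)
              (Finset.mem_filter.2 ⟨Finset.mem_univ _, rfl⟩)
          have h2 := hA i.m i.K i.j i.pow_ne_zero' i.hj i.Λ' i.w i.hw0 i.hw1 b₀ (i.site c)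
          calc _ ≤ _ := h1
            _ ≤ _ := h2
            _ ≤ CA * (Real.exp (δA * L) * Real.exp (-(δ₅ * (twoScaleGeo i.toFrame).dist y c))) := mul_le_mul_of_nonneg_left (hexp h5A b₀ hb) hCA
            _ = _ := by ring
        · exact hApos
      · haveI : Nonempty (PBond i.P 0 × Fin (d + 1)) := ⟨(⟨fun _ => 0, ⟨0, hd⟩⟩, ⟨0, hd⟩)⟩
        refine (ciSup_le fun q => ?_).trans (show CB * Real.exp (δB * L) * Real.exp (-(δ₅ * (twoScaleGeo i.toFrame).dist y c)) ≤ _ by nlinarith)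
        split_ifs with hb
        · have h1 : |(((((L : ℝ) ^ i.j) • (onE (LinearMap.funLeft ℝ ℝ (fun b : PBond i.P 0 => (⟨b.src.shift q.2, b.dir⟩ : PBond i.P 0))) - LinearMap.id) :
                  BondSpace i.P →ₗ[ℝ] BondSpace i.P)) ∘ₗ i.H) (EuclideanSpace.single c (1 : ℝ)) q.1| ≤
              ∑ k ∈ univ.filter (fun k : CIdx i.j i.Λ' => i.site k = i.site c),
                |(((((L : ℝ) ^ i.j) • (onE (LinearMap.funLeft ℝ ℝ (fun b : PBond i.P 0 => (⟨b.src.shift q.2, b.dir⟩ : PBond i.P 0))) - LinearMap.id) :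
                  BondSpace i.P →ₗ[ℝ] BondSpace i.P)) ∘ₗ i.H) (EuclideanSpace.single k (1 : ℝ)) q.1| :=
            Finset.single_le_sum (f := fun k : CIdx i.j i.Λ' =>
                |(((((L : ℝ) ^ i.j) • (onE (LinearMap.funLeft ℝ ℝ (fun b : PBond i.P 0 => (⟨b.src.shift q.2, b.dir⟩ : PBond i.P 0))) - LinearMap.id) :
                  BondSpace i.P →ₗ[ℝ] BondSpace i.P)) ∘ₗ i.H) (EuclideanSpace.single k (1 : ℝ)) q.1|) (fun _ _ => abs_nonneg _)
              (Finset.mem_filter.2 ⟨Finset.mem_univ c, rfl⟩)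
          have hD := Dop_comp_apply ((L : ℝ) ^ i.j) q.2 i.H (EuclideanSpace.single c (1 : ℝ)) q.1
          have h2 := hB i.m i.K i.j i.pow_ne_zero' i.hj i.Λ' i.w i.hw0 i.hw1 q.2 q.1 (i.site c)
          calc _ = |(((((L : ℝ) ^ i.j) • (onE (LinearMap.funLeft ℝ ℝ (fun b : PBond i.P 0 => (⟨b.src.shift q.2, b.dir⟩ : PBond i.P 0))) - LinearMap.id) :
                  BondSpace i.P →ₗ[ℝ] BondSpace i.P)) ∘ₗ i.H) (EuclideanSpace.single c (1 : ℝ)) q.1| := by rw [hD]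
            _ ≤ _ := h1
            _ ≤ _ := h2
            _ ≤ CB * (Real.exp (δB * L) * Real.exp (-(δ₅ * (twoScaleGeo i.toFrame).dist y c))) := mul_le_mul_of_nonneg_left (hexp h5B q.1 hb) hCB
            _ = _ := by ring
        · exact hBpos
    -- the length factors: `(L^{scale}η)^{−n} ≥ L^{−1}`, `(L^{scale}η)^{−(d+1)} ≥ L^{−(d+1)}`
    have hn1 : ((n : ℕ) : ℝ) ≤ 1 := by exact_mod_cast Nat.lt_succ_iff.mp n.isLt
    have hℓy := len_rpow_neg_ge i.toFrame y (Nat.cast_nonneg (n : ℕ)) hn1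
    have hℓc := len_rpow_neg_ge i.toFrame c (Nat.cast_nonneg (d + 1)) le_rfl
    have hLy : 1 ≤ (L : ℝ) ^ (1 : ℝ) * (twoScaleGeo i.toFrame).len y ^ (-((n : ℕ) : ℝ)) :=
      one_le_rpow_mul_len i.toFrame y (Nat.cast_nonneg (n : ℕ)) hn1
    have hLc : 1 ≤ (L : ℝ) ^ (((d + 1 : ℕ) : ℝ)) * (twoScaleGeo i.toFrame).len c ^ (-((d + 1 : ℕ) : ℝ)) :=
      one_le_rpow_mul_len i.toFrame c (Nat.cast_nonneg (d + 1)) le_rfl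
    have hE0 : 0 ≤ Real.exp (-(δ₅ * (twoScaleGeo i.toFrame).dist y c)) := (Real.exp_pos _).le
    have hS0 : 0 ≤ CA * Real.exp (δA * L) + CB * Real.exp (δB * L) := by positivity
    calc (twoScaleH i).e n y c ≤ (CA * Real.exp (δA * L) + CB * Real.exp (δB * L)) * Real.exp (-(δ₅ * (twoScaleGeo i.toFrame).dist y c)) * 1 * 1 := by
          rw [mul_one, mul_one]; exact key
      _ ≤ (CA * Real.exp (δA * L) + CB * Real.exp (δB * L)) * Real.exp (-(δ₅ * (twoScaleGeo i.toFrame).dist y c)) *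
            ((L : ℝ) ^ (1 : ℝ) * (twoScaleGeo i.toFrame).len y ^ (-((n : ℕ) : ℝ))) *
            ((L : ℝ) ^ (((d + 1 : ℕ) : ℝ)) * (twoScaleGeo i.toFrame).len c ^ (-((d + 1 : ℕ) : ℝ))) :=
          mul_le_mul (mul_le_mul_of_nonneg_left hLy (mul_nonneg hS0 hE0)) hLc zero_le_one (by positivity)
      _ = ((CA * Real.exp (δA * L) + CB * Real.exp (δB * L)) * ((L : ℝ) ^ (1 : ℝ) * (L : ℝ) ^ (((d + 1 : ℕ) : ℝ)))) *
            (twoScaleGeo i.toFrame).len y ^ (-((n : ℕ) : ℝ)) * (twoScaleGeo i.toFrame).len c ^ (-((d + 1 : ℕ) : ℝ)) *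
            Real.exp (-(δ₅ * (twoScaleGeo i.toFrame).dist y c)) := by ring
      _ ≤ C₀ * (twoScaleGeo i.toFrame).len y ^ (-((n : ℕ) : ℝ)) * (twoScaleGeo i.toFrame).len c ^ (-((d + 1 : ℕ) : ℝ)) *
            Real.exp (-(δ₅ * (twoScaleGeo i.toFrame).dist y c)) := by
          have hy0 : 0 ≤ (twoScaleGeo i.toFrame).len y ^ (-((n : ℕ) : ℝ)) := le_trans (by positivity) hℓy
          have hc0 : 0 ≤ (twoScaleGeo i.toFrame).len c ^ (-((d + 1 : ℕ) : ℝ)) := le_trans (by positivity) hℓc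
          have hle : (CA * Real.exp (δA * L) + CB * Real.exp (δB * L)) * ((L : ℝ) ^ (1 : ℝ) * (L : ℝ) ^ (((d + 1 : ℕ) : ℝ))) ≤ C₀ := by
            rw [hC₀]; linarith
          exact mul_le_mul_of_nonneg_right (mul_le_mul_of_nonneg_right (mul_le_mul_of_nonneg_right hle hy0) hc0) hE0
  · ------------------------------------------------------------------ the Hölder entry `h α ζ c`
    intro α ζ y c hα0 hα1 hζ
    beta_reduce
    rw [dif_pos (show 0 ≤ α ∧ α < 1 from ⟨hα0, hα1⟩)]
    set CH : ℝ := Classical.choose (HC α hα0 hα1) with hCHdef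
    obtain ⟨hCH, hH⟩ := Classical.choose_spec (HC α hα0 hα1)
    rw [← hCHdef] at hCH hH
    have hρ := torusDist_isPseudoDist i.M
    set Zh : ℝ := i.holderF α ζ
    set Z0 : ℝ := i.supF ζ
    have hZh : 0 ≤ Zh := i.holderF_nonneg α ζ
    have hZ0 : 0 ≤ Z0 := i.supF_nonneg ζ
    have hcut : (twoScaleGeo i.toFrame).cutH α ζ = Zh + Z0 := rfl
    set E : ℝ := Real.exp (-(δC * i.ρ (i.site y) (i.site c))) with hE
    set R : ℝ := CH * Real.exp ((1 + 2 * δC) * ((L : ℝ) + 1)) * E * (Zh + Z0) with hR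
    have hR0 : 0 ≤ R := by positivity
    -- termwise
    have hterm : ∀ q : (Site i.P 0 × Site i.P 0) × Fin (d + 1) × Fin (d + 1),
        (if supDist q.1.1 q.1.2 ≤ L ^ i.j then
          |ζ q.1.1 * (((L : ℝ) ^ i.j) * (i.H (EuclideanSpace.single c (1 : ℝ)) ⟨q.1.1.shift q.2.2, q.2.1⟩ - i.H (EuclideanSpace.single c (1 : ℝ)) ⟨q.1.1, q.2.1⟩)) -
            ζ q.1.2 * (((L : ℝ) ^ i.j) * (i.H (EuclideanSpace.single c (1 : ℝ)) ⟨q.1.2.shift q.2.2, q.2.1⟩ - i.H (EuclideanSpace.single c (1 : ℝ)) ⟨q.1.2, q.2.1⟩))| /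
            (((supDist q.1.1 q.1.2 : ℕ) : ℝ) / (L : ℝ) ^ i.j) ^ α
        else 0) ≤ R := fun q => by
      split_ifs with hq
      · obtain ⟨⟨x, x'⟩, ν, lam⟩ := q
        simp only at hq ⊢
        by_cases hxx : x = x'
        · subst hxx
          rw [sub_self, abs_zero, zero_div]
          exact hR0
        have htpos : 0 < (((supDist x x' : ℕ) : ℝ) / (L : ℝ) ^ i.j) ^ α := by
          have hne : supDist x x' ≠ 0 := fun h0 => hxx ((supDist_eq_zero_iff x x').mp h0)
          have : (0 : ℝ) < ((supDist x x' : ℕ) : ℝ) := by exact_mod_cast Nat.pos_of_ne_zero hne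
          exact Real.rpow_pos_of_pos (by positivity) _
        rw [div_le_iff₀ htpos]
        have h := hH i.m i.K i.j i.pow_ne_zero' i.hj i.Λ' i.w i.hw0 i.hw1 lam (L : ℝ) hL0.le (EuclideanSpace.single c (1 : ℝ)) 1 zero_le_one
          (i.site y) (i.site c)
          (fun k hk => by obtain rfl := eq_of_single_ne_zero hk; exact (hρ.zero _).le.trans hL0.le)
          (fun k => abs_single_le_one c k) ζ Zh Z0 hZh hZ0 hζ (fun x => i.abs_le_supF ζ x)
          ⟨x, ν⟩ ⟨x', ν⟩ rfl hq (i.abs_sub_le_holderF α ζ hq)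
        refine h.trans (le_of_eq ?_)
        simp only [hR, hE, mul_one]
      · exact hR0
    haveI : Nonempty ((Site i.P 0 × Site i.P 0) × Fin (d + 1) × Fin (d + 1)) := ⟨((fun _ => 0, fun _ => 0), ⟨0, hd⟩, ⟨0, hd⟩)⟩
    have hsup : (twoScaleH i).h α ζ c ≤ R := ciSup_le hterm
    -- the length factors and the rate
    have h1α2 : 1 + α ≤ 2 := by linarith
    have hLy : 1 ≤ (L : ℝ) ^ (2 : ℝ) * (twoScaleGeo i.toFrame).len y ^ (-(1 + α)) :=
      one_le_rpow_mul_len i.toFrame y (by linarith : (0 : ℝ) ≤ 1 + α) h1α2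
    have hLc : 1 ≤ (L : ℝ) ^ (((d + 1 : ℕ) : ℝ)) * (twoScaleGeo i.toFrame).len c ^ (-((d + 1 : ℕ) : ℝ)) :=
      one_le_rpow_mul_len i.toFrame c (Nat.cast_nonneg (d + 1)) le_rfl
    have hEE : E ≤ Real.exp (-(δ₅ * (twoScaleGeo i.toFrame).dist y c)) := by
      exact Real.exp_le_exp.2 (neg_le_neg (mul_le_mul_of_nonneg_right h5C (hρ.nonneg _ _)))
    have hE5 : 0 ≤ Real.exp (-(δ₅ * (twoScaleGeo i.toFrame).dist y c)) := (Real.exp_pos _).le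
    have hK0 : 0 ≤ CH * Real.exp ((1 + 2 * δC) * ((L : ℝ) + 1)) := by positivity
    calc (twoScaleH i).h α ζ c ≤ R := hsup
      _ = CH * Real.exp ((1 + 2 * δC) * ((L : ℝ) + 1)) * (Zh + Z0) * E * 1 * 1 := by rw [hR]; ring
      _ ≤ CH * Real.exp ((1 + 2 * δC) * ((L : ℝ) + 1)) * (Zh + Z0) * Real.exp (-(δ₅ * (twoScaleGeo i.toFrame).dist y c)) *
            ((L : ℝ) ^ (2 : ℝ) * (twoScaleGeo i.toFrame).len y ^ (-(1 + α))) *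
            ((L : ℝ) ^ (((d + 1 : ℕ) : ℝ)) * (twoScaleGeo i.toFrame).len c ^ (-((d + 1 : ℕ) : ℝ))) :=
          mul_le_mul (mul_le_mul (mul_le_mul_of_nonneg_left hEE (mul_nonneg hK0 (add_nonneg hZh hZ0))) hLy zero_le_one
            (by positivity)) hLc zero_le_one (by positivity)
      _ = CH * Real.exp ((1 + 2 * δC) * ((L : ℝ) + 1)) * ((L : ℝ) ^ (2 : ℝ) * (L : ℝ) ^ (((d + 1 : ℕ) : ℝ))) *
            (twoScaleGeo i.toFrame).len y ^ (-(1 + α)) * (twoScaleGeo i.toFrame).cutH α ζ * (twoScaleGeo i.toFrame).len c ^ (-((d + 1 : ℕ) : ℝ)) *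
            Real.exp (-(δ₅ * (twoScaleGeo i.toFrame).dist y c)) := by rw [hcut]; ring

/-- **Non-vacuity**: every member satisfies the hypotheses of `B6.Cor28Printed` with the witness `M₁ = 1` ((2.1)–(2.2) void, `M = 1`), and there is a
member for every volume, level, region `Λ′` and admissible weight — so (2.151) is asserted for all of them. [cite: Balaban1984PropagatorsII, Cor. 2.8 p.249] -/
theorem twoScale_meets_hypotheses (m K j : ℕ) (hj : j + 1 ≤ m + K) (Λ' : Finset (Site (⟨d + 1, L, m, K, hd, hL⟩ : Params) (j + 1)))
    (w : CIdx j Λ' → ℝ) (hw0 : ∀ i, a₀ * ((L : ℝ) ^ j) ^ (d + 1) ≤ w i) (hw1 : ∀ i, w i ≤ a₁ * ((L : ℝ) ^ j) ^ (d + 1)) :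
    ∃ i : Index d L hd hL a₀ a₁, i.m = m ∧ i.K = K ∧ i.j = j ∧ HEq i.Λ' Λ' ∧ HEq i.w w ∧
      (twoScaleGeo i.toFrame).Hyp21_22 ∧ (1 : ℝ) ≤ (twoScaleGeo i.toFrame).M :=
  ⟨⟨⟨m, K, j, hj, Λ'⟩, w, hw0, hw1⟩, rfl, rfl, rfl, HEq.rfl, HEq.rfl, trivial, le_rfl⟩

end Literature.MathematicalPhysics.QuantumFieldTheory.Balaban1983to89.B6Cor28PrintedTwoScaleV1

end
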